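import Mathlib
import Summits.NavierStokesRegularity.NavierStokesRegularity.Theorems.RootDecompLitSliceMeanFieldLaggedClosure
import Summits.NavierStokesRegularity.NavierStokesRegularity.Theorems.RootDecompLitSliceEnergyClockDissipation
import Summits.NavierStokesRegularity.NavierStokesRegularity.Theorems.RootDecompLitSliceMeanFieldTimeSide
import HarnessLib

/-!
# Route RootDecompLitSlice — cell Uᶜ `CritTameScarIsCritical` (stmt-NavierStokesRegularity-31733):
# the LAGGED endpoint closure — the `5/4`-homogeneous one-step bound of the mean-field lever closes
# energy-Type-I once the lag separates the PROXY level from the WINDOW level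

Helper toward Uᶜ (`--supports 31733`, no item, no node; census instrument decomp-ns-census-1 g58, tree probe
#53, file 2 of 2 (abstract part: `RootDecompLitSliceMeanFieldLaggedClosure`); sequel of the decomp-ns writer's `RootDecompLitSliceMeanFieldEndpoint` (p837169),
`RootDecompLitSliceMeanFieldBootstrap(Map)` (p836932 / p837180), `RootDecompLitSliceMeanFieldTimeSide`
(p838100)). Frame of Uᶜ: maximal smooth solution on `[0,T)`, Leray–Hopf on `[0,T]`, decaying datum, TAME at
`T`, CRITICAL CLOCK `∫|u(t)−u(T)|² ≤ K√(T−t)`; `τ = T − t`, `D(t) = ‖u(t)‖₂² − ‖u(T)‖₂² ≥ 0`, non-increasing.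

THE POINT (paper-level reading of the writer's ENDPOINT ANATOMY, HOME/writer/g43/NOTES-g43.md; critic rows
726/730). At the endpoint of the bootstrap (`a = 1/2`, proxy window `σ = mτ`) the writer's closing functional
for the single unknown `g = sup D/√τ` reads
`g ≤ K(1+2m^{1/4}) + m^{−1/4}·g + c K^{1/4}ν^{−5/4}(m^{−1/8} + m^{−1/4})·g^{5/4}` — SUPERLINEAR, hence «no
closure without smallness or an a-priori finiteness device» (critic c5/c6). But the one-step estimate is a bound
for `D(t)` in terms of TWO levels, the WINDOW level `φ₁ := D(t)/√τ` and the PROXY level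
`φ₀ := D(s)/√(T−s)` at the LAGGED time `s = T − mτ` (the proxy slice `ū = u(s')`, `s' ∈ (s, T)`, is paid by
`D(s)` alone — `MeanFieldTimeSide.exists_slice_dissipation_le`; the window dissipation `∫_t^T‖∇u‖² ≤ D(t)/2ν`
— `MeanFieldTimeSide.windowDissipation_le`; the clock is free). Keeping the two levels apart, the SAME terms
(writer's `T1`, `T3`, `T2a`, `T2b`; exponents certified in `MeanFieldBootstrapMap` / `MeanFieldClockRigidity`
at `μ = 1`) give
`φ₁ ≤ A(1+m^{1/4}) + B m^{−1/4} φ₀^{1/2}φ₁^{1/2} + c m^{−1/8} φ₀^{1/2}φ₁^{3/4} + c m^{−1/4} φ₀^{3/4}φ₁^{1/2}`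
(`A = 2K`, `B = √2`, `c ∝ C_S^{3/2}K^{1/4}ν^{−5/4}`; on the diagonal `φ₀ = φ₁ = g` this IS the writer's
functional, `rhs_diag`). In the UNKNOWN `φ₁` every power is `< 1`: the excess `1/4` of homogeneity sits on
the KNOWN lagged level `φ₀`. Consequently the map has an INVARIANT INTERVAL `[0, X]` — `φ₀ ≤ X ⟹ φ₁ ≤ X` as
soon as `B m^{−1/4} ≤ 1/4`, `c m^{−1/8}X^{1/4} ≤ 1/4` and `4A(1+m^{1/4}) ≤ X` (`quartic_invariant` /
`rpow_invariant`) — and such `X` exist for every large `m` because the floor grows like `m^{1/4}` while the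
admissible ceiling `(m^{1/8}/4c)^4` grows like `m^{1/2}`. Starting from ANY time `t₀` in the window
(`φ(t₀) < ∞` trivially) the geometric chain `T − (T−t₀)m^{−k}` stays below `X` by induction, and
monotonicity of `D` fills the gaps with a factor `√m` (`closure_of_laggedStep`): `D(t) ≤ X√m·√(T−t)` —
ENERGY-TYPE-I, hence Uᶜ's conclusion by `EnergyClockScarLaw.halfHolderClockCell`. No smallness of `K`, no
a-priori finiteness of `g`, no `L³`-oscillation hypothesis.

KERNEL CONTENT (def-free, standard axioms; the invariant interval `MeanFieldLaggedClosure.rpow_invariant`,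
the lagged bootstrap `MeanFieldLaggedClosure.closure_of_laggedStep` and the diagonal identity
`MeanFieldLaggedClosure.rhs_diag` are in file 1):
* `energyHalfHolder_of_laggedEndpointBound` — on the classical Leray–Hopf frame: the TWO-LEVEL LAGGED TERM
  BOUND (the inserted antecedent `hlag`, displayed below) forces `D(t) ≤ C√(T−t)` near `T`;
* `critTameScarIsCritical_of_laggedEndpointBound` — CELL FORM: Uᶜ's frame, clock hypothesis and conclusion
  VERBATIM with that ONE inserted antecedent.

THE INSERTED ANTECEDENT `hlag` (φ-currency; `D(r) := ∫‖u r‖² − ∫‖u T‖²`):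
`∃ A B c ≥ 0, ∃ T₁ < T, ∀ m ≥ 1, ∀ s ∈ (T₁,T), ∀ t ∈ (s,T), T − s = m(T − t) →`
`D(t)/√(T−t) ≤ A(1 + m^{1/4}) + (B/m^{1/4})·(D(s)/√(T−s))^{1/2}(D(t)/√(T−t))^{1/2}`
`  + (c/m^{1/8})·(D(s)/√(T−s))^{1/2}(D(t)/√(T−t))^{3/4} + (c/m^{1/4})·(D(s)/√(T−s))^{3/4}(D(t)/√(T−t))^{1/2}`.
D-currency dictionary (`τ = T−t`, `T−s = mτ`): the `B`-term is `(B/√m)·√(D(s)D(t))/√τ` (the writer's `hlin`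
term, `MeanFieldEndpoint`), the `c`-terms are `c m^{−3/8} D(s)^{1/2}D(t)^{3/4} τ^{−5/8}` and
`c m^{−5/8} D(s)^{3/4}D(t)^{1/2} τ^{−5/8}` — the writer's `T2a`/`T2b` with `‖∇ū‖²` paid by `D(s)/(ν mτ)` and
`∫_t^T‖∇u‖^{3/2}`, `∫_t^T‖∇u‖` paid by the window power means of `D(t)/2ν` (blueprint B3/B7, p838100).

STATUS / HONEST FRAMING. `hlag` is PAPER-LEVEL exactly like the writer's one-step `hstep` (same ingredients
B1–B8 at the simpler balance `σ = mτ`; B3–B7 landed as p838030/p838100, the tested balance B1/B2 not yet):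
this file does NOT discharge it. What it changes is the reading of the endpoint: granted the one-step analysis,
the endpoint `a = 1/2` (= Uᶜ: energy-Type-I ⟹ critical scars) is NOT a separate idea — the `5/4` is harmless
once lagged. Uᶜ is the Tao-vacuous, zero-load cell; no item, node or load of any route moves (ROOT ⟺ Uᵃ ∧ P1,
critic rows 354/371/698/717/726). Rung 0: nothing here proves NS regularity. [folklore]
-/

set_option linter.dupNamespace false

namespace Summit.NavierStokesRegularity.NavierStokesRegularity.Theorems

open MeasureTheory Set Filter Topology
open scoped ENNReal
open Literature.Analysis.FluidPDE

namespace MeanFieldLaggedEndpoint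

open MeanFieldLaggedClosure

/-! ## §3 Energy-Type-I from the two-level lagged term bound -/

/-- ★ **Energy-Type-I from the LAGGED (`5/4`-homogeneous) term bound.** On the classical Leray–Hopf frame
(classical on `[0,T)`, Leray–Hopf on `[0,T]`): if the energy drop `D(t) = ‖u(t)‖₂² − ‖u(T)‖₂²` obeys, for
some `A, B, c ≥ 0`, on a window `(T₁, T)`, for EVERY lag `m ≥ 1` and all `T₁ < s < t < T` with
`T − s = m(T − t)`, the two-level endpoint bound
`D(t)/√(T−t) ≤ A(1+m^{1/4}) + (B/m^{1/4})φ₀^{1/2}φ₁^{1/2} + (c/m^{1/8})φ₀^{1/2}φ₁^{3/4} + (c/m^{1/4})φ₀^{3/4}φ₁^{1/2}`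
(`φ₀ = D(s)/√(T−s)`, `φ₁ = D(t)/√(T−t)`; the mean-field one-step at `σ = m(T−t)` with the proxy level and the
window level kept apart), then `D(t) ≤ C√(T−t)` near `T`. Proof: `D ≥ 0` and non-increasing
(`MeanFieldTimeSide.energy_antitone`); start at `t₀ = (max T₁ 0 + T)/2` with `P = D(t₀)/√(T−t₀)`; lag
`m = M⁸`, `M = 2 + 4B + 4096c⁴A + 512c⁴(P+1)`; level `X = 8AM² + P + 1`; then `B/M² ≤ 1/4`,
`(c/M)X^{1/4} ≤ 1/4` (as `256c⁴X ≤ M⁴`), `4A(1+M²) ≤ X`, `P ≤ X`, so `rpow_invariant` is the step of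
`closure_of_laggedStep`. No clock, no tameness, no smallness, no a-priori finiteness enter here. [folklore] -/
theorem energyHalfHolder_of_laggedEndpointBound
    (ν T : ℝ) (hν : 0 < ν) (hT : 0 < T)
    (u : ℝ → EuclideanSpace ℝ (Fin 3) → EuclideanSpace ℝ (Fin 3)) (p : ℝ → EuclideanSpace ℝ (Fin 3) → ℝ)
    (hcl : IsClassicalNSSolutionOn (Ico 0 T) ν 0 u p) (hLH : IsLerayHopfOn T ν 0 (u 0) u)
    (hlag : ∃ A B c T₁ : ℝ, 0 ≤ A ∧ 0 ≤ B ∧ 0 ≤ c ∧ T₁ < T ∧ ∀ m : ℝ, 1 ≤ m →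
      ∀ s ∈ Ioo T₁ T, ∀ t ∈ Ioo s T, T - s = m * (T - t) →
      ((∫ x, ‖u t x‖ ^ 2) - ∫ x, ‖u T x‖ ^ 2) / Real.sqrt (T - t) ≤
        A * (1 + m ^ (1 / 4 : ℝ))
        + B / m ^ (1 / 4 : ℝ) *
          ((((∫ x, ‖u s x‖ ^ 2) - ∫ x, ‖u T x‖ ^ 2) / Real.sqrt (T - s)) ^ (1 / 2 : ℝ) *
            (((∫ x, ‖u t x‖ ^ 2) - ∫ x, ‖u T x‖ ^ 2) / Real.sqrt (T - t)) ^ (1 / 2 : ℝ))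
        + c / m ^ (1 / 8 : ℝ) *
          ((((∫ x, ‖u s x‖ ^ 2) - ∫ x, ‖u T x‖ ^ 2) / Real.sqrt (T - s)) ^ (1 / 2 : ℝ) *
            (((∫ x, ‖u t x‖ ^ 2) - ∫ x, ‖u T x‖ ^ 2) / Real.sqrt (T - t)) ^ (3 / 4 : ℝ))
        + c / m ^ (1 / 4 : ℝ) *
          ((((∫ x, ‖u s x‖ ^ 2) - ∫ x, ‖u T x‖ ^ 2) / Real.sqrt (T - s)) ^ (3 / 4 : ℝ) *
            (((∫ x, ‖u t x‖ ^ 2) - ∫ x, ‖u T x‖ ^ 2) / Real.sqrt (T - t)) ^ (1 / 2 : ℝ))) :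
    ∃ C T₂ : ℝ, T₂ < T ∧ ∀ t ∈ Ioo T₂ T,
      (∫ x, ‖u t x‖ ^ 2) - ∫ x, ‖u T x‖ ^ 2 ≤ C * Real.sqrt (T - t) := by
  obtain ⟨A, B, c, T₁, hA, hB, hc, hT₁, hlag⟩ := hlag
  set D : ℝ → ℝ := fun t => (∫ x, ‖u t x‖ ^ 2) - ∫ x, ‖u T x‖ ^ 2 with hDdef
  -- `D ≥ 0` and non-increasing on `[0, T)` (energy inequality restarted; no tameness needed)
  have hDnn : ∀ t ∈ Ico 0 T, 0 ≤ D t := by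
    intro t ht
    show 0 ≤ (∫ x, ‖u t x‖ ^ 2) - ∫ x, ‖u T x‖ ^ 2
    have := MeanFieldTimeSide.energy_antitone hν hcl hLH ht.1 ht.2.le le_rfl
    linarith
  have hDanti : ∀ s t : ℝ, 0 ≤ s → s ≤ t → t < T → D t ≤ D s := by
    intro s t hs hst htT
    show (∫ x, ‖u t x‖ ^ 2) - ∫ x, ‖u T x‖ ^ 2 ≤ (∫ x, ‖u s x‖ ^ 2) - ∫ x, ‖u T x‖ ^ 2
    have := MeanFieldTimeSide.energy_antitone hν hcl hLH hs hst htT.le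
    linarith
  -- the starting time and its level
  have hmaxT : max T₁ 0 < T := max_lt hT₁ hT
  obtain ⟨t₀, ht₀def⟩ : ∃ t₀ : ℝ, t₀ = (max T₁ 0 + T) / 2 := ⟨_, rfl⟩
  have ht₀T : t₀ < T := by rw [ht₀def]; linarith
  have hT₁t₀ : T₁ < t₀ := by rw [ht₀def]; linarith [le_max_left T₁ 0]
  have h0t₀ : 0 ≤ t₀ := by rw [ht₀def]; linarith [le_max_right T₁ 0]
  have hsq₀ : 0 < Real.sqrt (T - t₀) := Real.sqrt_pos.2 (by linarith)
  obtain ⟨P, hPdef⟩ : ∃ P : ℝ, P = D t₀ / Real.sqrt (T - t₀) := ⟨_, rfl⟩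
  have hP : 0 ≤ P := by rw [hPdef]; exact div_nonneg (hDnn t₀ ⟨h0t₀, ht₀T⟩) hsq₀.le
  -- the lag `m = M⁸`
  have hc4 : 0 ≤ c ^ 4 := by positivity
  have hc4A : 0 ≤ c ^ 4 * A := mul_nonneg hc4 hA
  have hc4P : 0 ≤ c ^ 4 * (P + 1) := mul_nonneg hc4 (by linarith)
  obtain ⟨M, hMdef⟩ : ∃ M : ℝ, M = 2 + 4 * B + 4096 * c ^ 4 * A + 512 * c ^ 4 * (P + 1) :=
    ⟨_, rfl⟩
  have hM2 : 2 ≤ M := by rw [hMdef]; linarith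
  have hM0 : 0 ≤ M := by linarith
  have hMpos : 0 < M := by linarith
  have hM1 : 1 ≤ M := by linarith
  have hMB : 4 * B ≤ M := by rw [hMdef]; linarith
  have hMA : 4096 * c ^ 4 * A ≤ M := by rw [hMdef]; linarith
  have hMP : 512 * c ^ 4 * (P + 1) ≤ M := by rw [hMdef]; linarith
  have hMM2 : M ≤ M ^ 2 := by nlinarith [mul_nonneg hM0 (sub_nonneg.2 hM1)]
  obtain ⟨m, hmdef⟩ : ∃ m : ℝ, m = M ^ 8 := ⟨_, rfl⟩
  have hm1 : 1 < m := by
    rw [hmdef]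
    calc (1 : ℝ) < 2 ^ 8 := by norm_num
      _ ≤ M ^ 8 := pow_le_pow_left₀ (by norm_num) hM2 8
  have em8 : m ^ (1 / 8 : ℝ) = M := by
    have h8 : (M ^ 8) ^ ((8 : ℕ) : ℝ)⁻¹ = M := Real.pow_rpow_inv_natCast hM0 (by norm_num)
    have e : ((8 : ℕ) : ℝ)⁻¹ = (1 / 8 : ℝ) := by norm_num
    rw [e] at h8
    rw [hmdef]; exact h8
  have em4 : m ^ (1 / 4 : ℝ) = M ^ 2 := by
    have h4 : ((M ^ 2) ^ 4) ^ ((4 : ℕ) : ℝ)⁻¹ = M ^ 2 :=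
      Real.pow_rpow_inv_natCast (pow_nonneg hM0 2) (by norm_num)
    have e : ((4 : ℕ) : ℝ)⁻¹ = (1 / 4 : ℝ) := by norm_num
    rw [e] at h4
    rw [hmdef, show M ^ 8 = (M ^ 2) ^ 4 by ring]; exact h4
  -- the level `X`
  obtain ⟨X, hXdef⟩ : ∃ X : ℝ, X = 8 * A * M ^ 2 + P + 1 := ⟨_, rfl⟩
  have hAM2 : 0 ≤ A * M ^ 2 := mul_nonneg hA (pow_nonneg hM0 2)
  have hX0 : 0 < X := by rw [hXdef]; linarith
  have hPX : P ≤ X := by rw [hXdef]; linarith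
  have hAX : 4 * (A * (1 + M ^ 2)) ≤ X := by
    rw [hXdef]
    have : A * 1 ≤ A * M ^ 2 := mul_le_mul_of_nonneg_left (hM1.trans hMM2) hA
    linarith
  have hq' : B / M ^ 2 ≤ 1 / 4 := by
    rw [div_le_iff₀ (by positivity)]
    linarith [hMB, hMM2]
  -- `256 c⁴ X ≤ M⁴`, hence `(c/M)·X^{1/4} ≤ 1/4`
  have hM3 : M ^ 3 ≤ M ^ 4 / 2 := by
    have e : M ^ 4 = M * M ^ 3 := by ring
    nlinarith [mul_nonneg (sub_nonneg.2 hM2) (pow_nonneg hM0 3)]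
  have hM14 : M ≤ M ^ 4 / 8 := by
    have h8 : 8 ≤ M ^ 3 := le_trans (by norm_num) (pow_le_pow_left₀ (by norm_num) hM2 3)
    have e : M ^ 4 = M * M ^ 3 := by ring
    nlinarith [mul_nonneg (sub_nonneg.2 h8) hM0]
  have hpoly : 256 * c ^ 4 * X ≤ M ^ 4 := by
    have e1 : 2048 * c ^ 4 * A * M ^ 2 ≤ M ^ 4 / 4 := by
      have h1 : (4096 * c ^ 4 * A) * M ^ 2 ≤ M * M ^ 2 :=
        mul_le_mul_of_nonneg_right hMA (pow_nonneg hM0 2)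
      have h2 : M * M ^ 2 = M ^ 3 := by ring
      rw [h2] at h1
      linarith
    have e2 : 256 * c ^ 4 * (P + 1) ≤ M ^ 4 / 16 := by linarith
    have e3 : 256 * c ^ 4 * X = 2048 * c ^ 4 * A * M ^ 2 + 256 * c ^ 4 * (P + 1) := by
      rw [hXdef]; ring
    rw [e3]
    have : 0 ≤ M ^ 4 := pow_nonneg hM0 4
    linarith
  have hroot : 4 * c * X ^ (1 / 4 : ℝ) ≤ M := by
    have hX4 : (X ^ (1 / 4 : ℝ)) ^ 4 = X := by
      rw [← Real.rpow_mul_natCast hX0.le]; norm_num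
    have h4 : (4 * c * X ^ (1 / 4 : ℝ)) ^ 4 ≤ M ^ 4 := by
      rw [mul_pow, hX4]
      have : (4 * c) ^ 4 = 256 * c ^ 4 := by ring
      rw [this]; exact hpoly
    exact (pow_le_pow_iff_left₀ (by positivity) hM0 (by norm_num)).1 h4
  have hc₁' : c / M * X ^ (1 / 4 : ℝ) ≤ 1 / 4 := by
    rw [div_mul_eq_mul_div, div_le_iff₀ hMpos]; linarith
  have hc₂' : c / M ^ 2 * X ^ (1 / 4 : ℝ) ≤ 1 / 4 := by
    have h1 : c / M ^ 2 ≤ c / M := div_le_div_of_nonneg_left hc hMpos hMM2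
    have h2 : c / M ^ 2 * X ^ (1 / 4 : ℝ) ≤ c / M * X ^ (1 / 4 : ℝ) :=
      mul_le_mul_of_nonneg_right h1 (Real.rpow_nonneg hX0.le _)
    exact h2.trans hc₁'
  -- the step of the lagged bootstrap
  have hstep : ∀ s t : ℝ, t₀ ≤ s → s < t → t < T → T - s = m * (T - t) →
      D s ≤ X * Real.sqrt (T - s) → D t ≤ X * Real.sqrt (T - t) := by
    intro s t hs hst htT hlagEq hDs
    have hsI : s ∈ Ioo T₁ T := ⟨lt_of_lt_of_le hT₁t₀ hs, hst.trans htT⟩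
    have htI : t ∈ Ioo s T := ⟨hst, htT⟩
    have hsqs : 0 < Real.sqrt (T - s) := Real.sqrt_pos.2 (by linarith)
    have hsqt : 0 < Real.sqrt (T - t) := Real.sqrt_pos.2 (by linarith)
    have hφ₀ : 0 ≤ D s / Real.sqrt (T - s) :=
      div_nonneg (hDnn s ⟨h0t₀.trans hs, hsI.2⟩) hsqs.le
    have hφ₁ : 0 ≤ D t / Real.sqrt (T - t) :=
      div_nonneg (hDnn t ⟨(h0t₀.trans hs).trans hst.le, htT⟩) hsqt.le
    have hφ₀X : D s / Real.sqrt (T - s) ≤ X := by rw [div_le_iff₀ hsqs]; exact hDs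
    have h : D t / Real.sqrt (T - t) ≤
        A * (1 + m ^ (1 / 4 : ℝ))
        + B / m ^ (1 / 4 : ℝ) *
          ((D s / Real.sqrt (T - s)) ^ (1 / 2 : ℝ) * (D t / Real.sqrt (T - t)) ^ (1 / 2 : ℝ))
        + c / m ^ (1 / 8 : ℝ) *
          ((D s / Real.sqrt (T - s)) ^ (1 / 2 : ℝ) * (D t / Real.sqrt (T - t)) ^ (3 / 4 : ℝ))
        + c / m ^ (1 / 4 : ℝ) *
          ((D s / Real.sqrt (T - s)) ^ (3 / 4 : ℝ) * (D t / Real.sqrt (T - t)) ^ (1 / 2 : ℝ)) :=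
      hlag m hm1.le s hsI t htI hlagEq
    rw [em4, em8] at h
    have key := rpow_invariant (A := A * (1 + M ^ 2)) (div_nonneg hB (pow_nonneg hM0 2))
      (div_nonneg hc hM0) (div_nonneg hc (pow_nonneg hM0 2)) hX0.le hφ₀ hφ₁ hq' hc₁' hc₂' hAX hφ₀X h
    rwa [div_le_iff₀ hsqt] at key
  have hstart : D t₀ ≤ X * Real.sqrt (T - t₀) := by
    have : D t₀ = P * Real.sqrt (T - t₀) := by rw [hPdef, div_mul_cancel₀ _ hsq₀.ne']
    rw [this]; exact mul_le_mul_of_nonneg_right hPX hsq₀.le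
  have hanti' : ∀ s t : ℝ, t₀ ≤ s → s ≤ t → t < T → D t ≤ D s :=
    fun s t hs hst htT => hDanti s t (h0t₀.trans hs) hst htT
  have hfin := closure_of_laggedStep ht₀T hm1 hX0.le hanti' hstart hstep
  exact ⟨X * Real.sqrt m, t₀, ht₀T, fun t ht => hfin t ⟨ht.1.le, ht.2⟩⟩

/-! ## §4 Cell form -/

/-- **Cell form**: Uᶜ `CritTameScarIsCritical`'s frame (maximal smooth solution, Leray–Hopf, decaying datum,
tame at `T`), its √-clock hypothesis and its conclusion VERBATIM, with ONE inserted antecedent — the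
TWO-LEVEL LAGGED TERM BOUND of the energy drop (`∃ A B c ≥ 0, ∃ T₁ < T, ∀ m ≥ 1, ∀ T₁ < s < t < T` with
`T − s = m(T−t)`: `D(t)/√(T−t) ≤ A(1+m^{1/4}) + (B/m^{1/4})φ₀^{1/2}φ₁^{1/2} + (c/m^{1/8})φ₀^{1/2}φ₁^{3/4}
+ (c/m^{1/4})φ₀^{3/4}φ₁^{1/2}`, `φ₀ = D(s)/√(T−s)`, `φ₁ = D(t)/√(T−t)`) — the writer's endpoint functional
with the proxy level and the window level kept apart (`rhs_diag`). Closed by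
`energyHalfHolder_of_laggedEndpointBound` + `EnergyClockScarLaw.halfHolderClockCell`. The antecedent is the
`σ = m(T−t)` instance of the paper-level one-step (blueprint B1–B8); it is NOT discharged here. [folklore] -/
theorem critTameScarIsCritical_of_laggedEndpointBound :
    ∀ (ν T : ℝ), 0 < ν → 0 < T → ∀ (u : ℝ → EuclideanSpace ℝ (Fin 3) → EuclideanSpace ℝ (Fin 3))
      (p : ℝ → EuclideanSpace ℝ (Fin 3) → ℝ),
      Literature.Analysis.FluidPDE.IsMaximalSmoothSolution ν 0 u p T →
      Literature.Analysis.FluidPDE.IsLerayHopfOn T ν 0 (u 0) u →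
      Literature.Analysis.FluidPDE.HasRapidSpatialDecay (u 0) →
      Filter.Tendsto (fun t => MeasureTheory.eLpNorm (u t - u T) 2 MeasureTheory.volume)
        (nhdsWithin T (Set.Iio T)) (nhds 0) →
      (∃ K T₁ : ℝ, T₁ < T ∧ ∀ t ∈ Set.Ioo T₁ T,
        ∫⁻ x, ‖u t x - u T x‖ₑ ^ 2 ≤ ENNReal.ofReal (K * Real.sqrt (T - t))) →
      (∃ A B c T₁ : ℝ, 0 ≤ A ∧ 0 ≤ B ∧ 0 ≤ c ∧ T₁ < T ∧ ∀ m : ℝ, 1 ≤ m →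
        ∀ s ∈ Set.Ioo T₁ T, ∀ t ∈ Set.Ioo s T, T - s = m * (T - t) →
        ((∫ x, ‖u t x‖ ^ 2) - ∫ x, ‖u T x‖ ^ 2) / Real.sqrt (T - t) ≤
          A * (1 + m ^ (1 / 4 : ℝ))
          + B / m ^ (1 / 4 : ℝ) *
            ((((∫ x, ‖u s x‖ ^ 2) - ∫ x, ‖u T x‖ ^ 2) / Real.sqrt (T - s)) ^ (1 / 2 : ℝ) *
              (((∫ x, ‖u t x‖ ^ 2) - ∫ x, ‖u T x‖ ^ 2) / Real.sqrt (T - t)) ^ (1 / 2 : ℝ))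
          + c / m ^ (1 / 8 : ℝ) *
            ((((∫ x, ‖u s x‖ ^ 2) - ∫ x, ‖u T x‖ ^ 2) / Real.sqrt (T - s)) ^ (1 / 2 : ℝ) *
              (((∫ x, ‖u t x‖ ^ 2) - ∫ x, ‖u T x‖ ^ 2) / Real.sqrt (T - t)) ^ (3 / 4 : ℝ))
          + c / m ^ (1 / 4 : ℝ) *
            ((((∫ x, ‖u s x‖ ^ 2) - ∫ x, ‖u T x‖ ^ 2) / Real.sqrt (T - s)) ^ (3 / 4 : ℝ) *
              (((∫ x, ‖u t x‖ ^ 2) - ∫ x, ‖u T x‖ ^ 2) / Real.sqrt (T - t)) ^ (1 / 2 : ℝ))) →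
      ∀ x₀ : EuclideanSpace ℝ (Fin 3), ∃ M r₁ : ℝ, 0 < r₁ ∧ ∀ r ∈ Set.Ioo 0 r₁,
        r⁻¹ * ∫ x in Metric.ball x₀ r, ‖u T x‖ ^ 2 ≤ M :=
  fun ν T hν hT u p hmax hLH hdec htame hclock hlag x₀ =>
    EnergyClockScarLaw.halfHolderClockCell ν T hν hT u p hmax hLH hdec htame hclock
      (energyHalfHolder_of_laggedEndpointBound ν T hν hT u p hmax.1 hLH hlag) x₀

end MeanFieldLaggedEndpoint

end Summit.NavierStokesRegularity.NavierStokesRegularity.Theorems
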